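import Mathlib
import HarnessLib
import Summits.HubbardSuperconductivity.HubbardSuperconductivity.Theorems.KLProgrammeKLRegimeEngineV8DefsG13
import Summits.HubbardSuperconductivity.HubbardSuperconductivity.Theorems.KLProgrammeKLRegimeSplitSlotsV17F2

/-!
# Route `KLProgramme` — ENGINE item stmt-HubbardSuperconductivity-20437 `KLRegimeEngineV17F2`: the value/ladder conjuncts of `EngineBoundsAtV17F2` are MONOTONE IN THE PACKAGE `G`,
# and their lifts along the AMENDMENT-24 token move `klEngGeo11 ↦ klEngGeo13` (cell gate-hubbard-kl, seat hubbard-kl-k3c2-p2 g19; plan g23 (R243)(3))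

For a registrant re-rendering the engine image at a new `G` token, every conjunct stated as an UPPER bound in `G`'s gains / `CF` (with the block / drive / edge /
localisation fields unchanged) transfers from the smaller package to the larger one by a names-only lemma.  Generic in `(G, G′)` with
`G.ppGain ≤ G′.ppGain`, `G.phGain ≤ G′.phGain`, `G.CF ≤ G′.CF` and `bhi, cloc, θ, aplus, ζ, atop, abot` equal:
* `gainBar_mono_pkg`, `eremBar_eq_pkg`, `drivePBar_eq_pkg`, `klEdge_eq_pkg`, `initDevBar_eq_pkg`;
* **`pairValueIncrementAtV17F_mono`**, **`quarticValueIncrementAtV17F_mono`**, `quarticValueUVAtV17F_mono`, **`pairLadderStepAtV17F2_mono`**, `isoTupleL1AtV17F_mono`;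
* the instances **`…_klEngGeo13_of_klEngGeo11`** (field rows of …DefsG13: `rfl` for the untouched fields, `…_le_klEngGeo13_…` for the gains and `CF`).
Monotonicity bookkeeping only; nothing about the model is asserted; nothing asserts (E2″-F), (c), K3 or superconductivity.  0 kit · 0 lit.
-/

noncomputable section

namespace Summit.HubbardSuperconductivity.HubbardSuperconductivity.Theorems.KLRegimeSplit

set_option linter.dupNamespace false -- summit = problem name (single-conjunct summit), D-0017

open Real Finset Literature.MathematicalPhysics.QuantumLattice Literature.Probability.LatticeModels
open Summit.HubbardSuperconductivity.HubbardSuperconductivity.Theorems.KLProgrammeLegKernels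
open Summit.HubbardSuperconductivity.HubbardSuperconductivity.Theorems.DispersionFlow
open Summit.HubbardSuperconductivity.HubbardSuperconductivity.Theorems.EngineV8

/-! ## §1 Package comparison data and the slot majorants -/

/-- **`G ≼ G′` for the value/ladder slots**: gains and `CF` grow, the other read fields are equal. -/
structure GeoConsts.SlotLE (G G' : GeoConsts) : Prop where
  /-- pp gains grow -/
  ppGain_le : ∀ n ρ, G.ppGain n ρ ≤ G'.ppGain n ρ
  /-- ph gains grow -/
  phGain_le : ∀ n ρ, G.phGain n ρ ≤ G'.phGain n ρ
  /-- freezing constant grows -/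
  CF_le : G.CF ≤ G'.CF
  /-- bubble mass unchanged -/
  bhi_eq : G'.bhi = G.bhi
  /-- localisation slack unchanged -/
  cloc_eq : G'.cloc = G.cloc
  /-- its rate unchanged -/
  θ_eq : G'.θ = G.θ
  /-- repulsive drive unchanged -/
  aplus_eq : G'.aplus = G.aplus
  /-- drive profile unchanged -/
  ζ_eq : G'.ζ = G.ζ
  /-- block tops unchanged -/
  atop_eq : G'.atop = G.atop
  /-- block bottoms unchanged -/
  abot_eq : G'.abot = G.abot

namespace GeoConsts.SlotLE

variable {G G' : GeoConsts} (h : GeoConsts.SlotLE G G')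
include h

/-- `gainBar` grows. -/
theorem gainBar_mono (P : SplitConsts) (U : ℝ) (n : ℕ) (ρpp ρd ρx : ℝ) : gainBar G P U n ρpp ρd ρx ≤ gainBar G' P U n ρpp ρd ρx := by
  unfold gainBar
  have h1 := h.ppGain_le n ρpp; have h2 := h.phGain_le n ρd; have h3 := h.phGain_le n ρx
  exact mul_le_mul_of_nonneg_left (by linarith) (sq_nonneg _)

/-- `eremBar` is unchanged. -/
theorem eremBar_eq (P : SplitConsts) (Q : EngConsts) (U β : ℝ) (L n : ℕ) : eremBar G' P Q U β L n = eremBar G P Q U β L n := by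
  unfold eremBar; rw [h.cloc_eq, h.θ_eq]

/-- `thermalBar` grows. -/
theorem thermalBar_mono (P : SplitConsts) (U β : ℝ) (n : ℕ) : thermalBar G P U β n ≤ thermalBar G' P U β n :=
  KLRegimeSplit.thermalBar_mono h.CF_le P U β n

/-- `drivePBar` is unchanged. -/
theorem drivePBar_eq (P : SplitConsts) (U : ℝ) (n : ℕ) : drivePBar G' P U n = drivePBar G P U n := by
  unfold drivePBar; rw [h.aplus_eq, h.ζ_eq]

/-- `klEdge` is unchanged. -/
theorem klEdge_eq (n : ℕ) (ρ : ℝ) : klEdge G' n ρ = klEdge G n ρ := by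
  unfold klEdge; rw [h.bhi_eq]

/-- `initDevBar` is unchanged. -/
theorem initDevBar_eq (U : ℝ) : initDevBar G' U = initDevBar G U := by
  unfold initDevBar; rw [h.atop_eq, h.abot_eq]

/-! ## §2 The conjuncts are monotone in the package -/

variable {L M : ℕ} [NeZero L] [NeZero M] {P : SplitConsts} {Q : EngConsts} {β U μ : ℝ} {n : ℕ}

/-- **(E2″-F) is monotone in `G`.** -/
theorem pairValueIncrementAtV17F_mono (hE : PairValueIncrementAtV17F L M G P Q β U μ n) : PairValueIncrementAtV17F L M G' P Q β U μ n := by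
  intro hn Qm k hk k' hk'
  refine (hE hn Qm k hk k' hk').trans ?_
  have h1 := h.gainBar_mono P U n (klTorusNorm L Qm) (klTorusNorm L (k - k')) (klTorusNorm L (k + k' - Qm))
  have h2 := h.eremBar_eq P Q U β L (n - 1)
  have h3 := h.thermalBar_mono P U β n
  rw [h2, legDressBarQ2_eq G', legDressBarQ2_eq G]
  linarith

/-- **(E2′-F) is monotone in `G`.** -/
theorem quarticValueIncrementAtV17F_mono (hE : QuarticValueIncrementAtV17F L M G P Q β U μ n) : QuarticValueIncrementAtV17F L M G' P Q β U μ n := by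
  intro hn k₁ hk₁ k₂ hk₂ k₃ hk₃
  refine (hE hn k₁ hk₁ k₂ hk₂ k₃ hk₃).trans ?_
  have h1 := h.gainBar_mono P U n (klTorusNorm L (k₁ + k₃)) (klTorusNorm L (k₁ - k₂)) (klTorusNorm L (k₂ - k₃))
  have h2 := h.eremBar_eq P Q U β L (n - 1)
  have h3 := h.thermalBar_mono P U β n
  rw [h2, legDressBarQ2_eq G', legDressBarQ2_eq G]
  linarith

/-- **(E2′-F UV) is unchanged in `G` up to `initDevBar`** (monotone form). -/
theorem quarticValueUVAtV17F_mono (hE : QuarticValueUVAtV17F L M G P Q β U μ n) : QuarticValueUVAtV17F L M G' P Q β U μ n := by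
  intro hn k₁ hk₁ k₂ hk₂ k₃ hk₃
  refine (hE hn k₁ hk₁ k₂ hk₂ k₃ hk₃).trans ?_
  rw [h.initDevBar_eq, legDressBarQ2_eq G', legDressBarQ2_eq G]

/-- **(E2-F2) is monotone in `G`.** -/
theorem pairLadderStepAtV17F2_mono (hE : PairLadderStepAtV17F2 L M G P Q β U μ n) : PairLadderStepAtV17F2 L M G' P Q β U μ n := by
  refine ⟨fun hn Qm k hk k' hk' => ?_, fun hn Qm hQ => ?_⟩
  · refine (hE.1 hn Qm k hk k' hk').trans ?_
    rw [h.initDevBar_eq, legDressBarQ2_eq G', legDressBarQ2_eq G]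
  · obtain ⟨w, hw1, hw2, N, hN, hb⟩ := hE.2 hn Qm hQ
    refine ⟨w, by rw [h.bhi_eq]; exact hw1, by rw [h.klEdge_eq]; exact hw2, N, hN, fun k hk k' hk' => (hb k hk k' hk').trans ?_⟩
    have h1 := h.phGain_le n (klTorusNorm L (k - k'))
    have h2 := h.phGain_le n (klTorusNorm L (k + k' - Qm))
    have h3 := h.eremBar_eq P Q U β L (n - 1)
    have h4 := h.thermalBar_mono P U β n
    have h5 := h.drivePBar_eq P U (n - 1)
    have hK : 0 ≤ (P.Klam * U) ^ 2 := sq_nonneg _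
    rw [h3, h5, legDressBarQ2_eq G', legDressBarQ2_eq G]
    nlinarith

/-- **(E5-F) is monotone in `G`** (`0 ≤ B`, `0 ≤ (Klam U)²`). -/
theorem isoTupleL1AtV17F_mono (hE : IsoTupleL1AtV17F L M G P β U μ n) : IsoTupleL1AtV17F L M G' P β U μ n := by
  intro B hB hvals m hm Ω hΩ x₁
  refine (hE B hB hvals m hm Ω hΩ x₁).trans ?_
  have hCF := h.CF_le
  have hK : 0 ≤ (P.Klam * U) ^ 2 := sq_nonneg _
  nlinarith

end GeoConsts.SlotLE

/-! ## §3 The AMENDMENT-24 instance `klEngGeo11 ≼ klEngGeo13` -/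

/-- **`klEngGeo11 ≼ klEngGeo13`.** -/
theorem slotLE_klEngGeo11_klEngGeo13 : GeoConsts.SlotLE klEngGeo11 klEngGeo13 where
  ppGain_le := klEngGeo11_ppGain_le_klEngGeo13_ppGain
  phGain_le := klEngGeo11_phGain_le_klEngGeo13_phGain
  CF_le := klEngGeo11_CF_le_klEngGeo13_CF
  bhi_eq := klEngGeo13_bhi
  cloc_eq := klEngGeo13_cloc
  θ_eq := klEngGeo13_θ
  aplus_eq := klEngGeo13_aplus
  ζ_eq := klEngGeo13_ζ
  atop_eq := klEngGeo13_atop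
  abot_eq := klEngGeo13_abot

section Model

variable {L M : ℕ} [NeZero L] [NeZero M] {P : SplitConsts} {Q : EngConsts} {β U μ : ℝ} {n : ℕ}

/-- (E2″-F) lifts along `klEngGeo11 ↦ klEngGeo13`. -/
theorem pairValueIncrementAtV17F_klEngGeo13_of_klEngGeo11 (h : PairValueIncrementAtV17F L M klEngGeo11 P Q β U μ n) :
    PairValueIncrementAtV17F L M klEngGeo13 P Q β U μ n := slotLE_klEngGeo11_klEngGeo13.pairValueIncrementAtV17F_mono h

/-- (E2′-F) lifts along `klEngGeo11 ↦ klEngGeo13`. -/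
theorem quarticValueIncrementAtV17F_klEngGeo13_of_klEngGeo11 (h : QuarticValueIncrementAtV17F L M klEngGeo11 P Q β U μ n) :
    QuarticValueIncrementAtV17F L M klEngGeo13 P Q β U μ n := slotLE_klEngGeo11_klEngGeo13.quarticValueIncrementAtV17F_mono h

/-- (E2′-F UV) lifts along `klEngGeo11 ↦ klEngGeo13`. -/
theorem quarticValueUVAtV17F_klEngGeo13_of_klEngGeo11 (h : QuarticValueUVAtV17F L M klEngGeo11 P Q β U μ n) :
    QuarticValueUVAtV17F L M klEngGeo13 P Q β U μ n := slotLE_klEngGeo11_klEngGeo13.quarticValueUVAtV17F_mono h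

/-- (E2-F2) lifts along `klEngGeo11 ↦ klEngGeo13`. -/
theorem pairLadderStepAtV17F2_klEngGeo13_of_klEngGeo11 (h : PairLadderStepAtV17F2 L M klEngGeo11 P Q β U μ n) :
    PairLadderStepAtV17F2 L M klEngGeo13 P Q β U μ n := slotLE_klEngGeo11_klEngGeo13.pairLadderStepAtV17F2_mono h

end Model

end Summit.HubbardSuperconductivity.HubbardSuperconductivity.Theorems.KLRegimeSplit

end
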